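import Literature.AlgebraicGeometry.HodgeTheory.ProductFactorsHodgeDescent
import Literature.AlgebraicGeometry.HodgeTheory.LefschetzOneOneHolds
import Summits.HodgeConjecture.HodgeConjecture.Theorems.SoloBlindSquareChain
import Summits.HodgeConjecture.HodgeConjecture.Statement
import HarnessLib

/-!
# The dimension chain of the summit and the threshold triangle

Solo-blind residency on `HodgeConjecture`, session s186; claims SB-C1401 – SB-C1404 of its
`CLAIMS.jsonl`, companion prose `work/s186/dimchain186.md`, front sheet `paper/sharpest.md` §1 (1l).

A KERNEL COROLLARY of theorems already in the tree, recorded at summit level; bookkeeping, no new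
input, novelty not claimed. `DimHodge n` is the Hodge conjecture for ALL smooth projective complex
`n`-folds (every degree). Three facts organise the summit by dimension:

* **chain** (`dimHodge_of_add`): `DimHodge (n + k) → DimHodge n` — test the `n`-fold `X` on the
  `(n + k)`-fold `X × ℙᵏ` and descend along the surjection `pr₁` (the tree's
  `hodgeConjectureFor_of_tensor_left`, Arapura's Lemma 4.2); so `DimHodge` is antitone, a
  counterexample in dimension `n` propagates to every dimension `≥ n`, and the summit is equivalent to
  `DimHodge` on ANY unbounded set of dimensions (`hodgeConjecture_iff_dimHodge_of_unbounded`; e.g. all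
  multiples of a fixed `k ≥ 1`, `hodgeConjecture_iff_forall_dimHodge_mul`);
* **floor** (`dimHodge_of_le_three`): `DimHodge n` is a theorem for `n ≤ 3` (Lefschetz `(1,1)` and
  its hard-Lefschetz dual, the tree's `hodgeConjectureFor_of_dim_le_three_holds`), so the THRESHOLD
  FORM reads `¬ HodgeConjecture ↔ ∃ D₁ ≥ 4, ∀ n, DimHodge n ↔ n < D₁`
  (`not_hodgeConjecture_iff_exists_dimThreshold`);
* **links** with the two other chains of this residency (`MiddleHodge`, `SoloBlindMiddleMonotone`;
  `SquareHodge`, `SoloBlindSquareChain`): `MiddleHodge n → DimHodge n` (sharp and pointwise: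
  every degree on an `n`-fold is the middle degree of some `X × ℙʳ` of dimension `≤ 2n`,
  Brosnan–Fang–Nie–Pearlstein Lemma 48 one variety at a time), `DimHodge (2m) → MiddleHodge m`,
  `SquareHodge (2n) → DimHodge n`, `DimHodge (2N) → SquareHodge N`. Hence, if the Hodge conjecture
  fails, the three first-failure levels `M₁` (middle degree of `2m`-folds), `D₁` (dimension), `N₁`
  (squares `X × X`, `dim X = N`) satisfy the THRESHOLD TRIANGLE
  `M₁ ≤ D₁ ≤ 2 M₁`, `M₁ ≤ N₁ ≤ 3 M₁`, `N₁ ≤ 2 D₁`, `D₁ ≤ 2 N₁` (with `M₁ ≥ 2`, `N₁ ≥ 2`, `D₁ ≥ 4`).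

What it buys (bookkeeping, not a reduction of difficulty): the precise sense in which "the first
open case" of the Hodge conjecture is simultaneously the fourfold / `(2,2)` case (`M₁ ≥ 2`,
`D₁ ≥ 4`) and the self-product-of-surfaces case (`N₁ ≥ 2`), and the quantitative statement that a
single counterexample pins all three thresholds to within a factor `≤ 3` of each other.

## References

* [BrosnanFangNiePearlstein2009] P. Brosnan, H. Fang, Z. Nie, G. Pearlstein, Singularities of
  admissible normal functions, Invent. Math. 177 (2009), §6 Lemma 48 (arXiv:0711.0964, p. 13).
* [Arapura2006] D. Arapura, Motivation for Hodge cycles, Adv. Math. 207 (2006), §4 Lemma 4.2, §1 Cor. 1.2.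
* [VoisinHodgeI2002] C. Voisin, Hodge Theory and Complex Algebraic Geometry I (2002), §7.3.2, §11.3.
* [Deligne2000] P. Deligne, The Hodge conjecture, Clay problem description (2000), §1.
-/

noncomputable section

open CategoryTheory CategoryTheory.Limits AlgebraicGeometry MonoidalCategory CartesianMonoidalCategory
open Literature.AlgebraicGeometry Literature.AlgebraicGeometry.Motives
open Literature.AlgebraicGeometry.HodgeTheory
open Literature.AlgebraicTopology.SingularHomology

namespace Summit.HodgeConjecture.HodgeConjecture.Theorems.SoloBlind

/-- **The Hodge conjecture in dimension `n`.** `DimHodge n`: every smooth projective complex variety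
of dimension `n` satisfies the Hodge conjecture (all degrees), i.e. the tree's `HodgeConjectureFor n X`
for every such `X`. [cite: Deligne2000, §1] -/
@[conjecture] def DimHodge (n : ℕ) : Prop :=
  ∀ ⦃X : Motives.SchemeOver ℂ⦄, Motives.IsSmoothProjective n X → HodgeConjectureFor n X

/-- Specialisation: the Hodge conjecture implies `DimHodge n`. [cite: Deligne2000, §1] -/
theorem dimHodge_of_hodgeConjecture (h : _root_.HodgeConjecture) (n : ℕ) : DimHodge n :=
  fun _ hX ↦ h hX

/-- `DimHodge n` for every `n` is the Hodge conjecture (definitional). [cite: Deligne2000, §1] -/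
theorem hodgeConjecture_of_forall_dimHodge (h : ∀ n, DimHodge n) : _root_.HodgeConjecture :=
  fun n _ hX ↦ h n hX

/-- **The dimension form of the summit**: `HodgeConjecture ↔ ∀ n, DimHodge n`. [cite: Deligne2000, §1] -/
theorem hodgeConjecture_iff_forall_dimHodge : _root_.HodgeConjecture ↔ ∀ n, DimHodge n :=
  ⟨dimHodge_of_hodgeConjecture, hodgeConjecture_of_forall_dimHodge⟩

/-- **Floor**: `DimHodge n` is a theorem for `n ≤ 3` (Lefschetz's theorem on `(1,1)`-classes and its
hard-Lefschetz dual in degree `2n - 2`; the tree's `hodgeConjectureFor_of_dim_le_three_holds`).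
[cite: VoisinHodgeI2002, Thm. 11.30 and §11.3] -/
theorem dimHodge_of_le_three {n : ℕ} (hn : n ≤ 3) : DimHodge n :=
  fun _ hX ↦ hodgeConjectureFor_of_dim_le_three_holds hn hX

/-- **Chain, with an auxiliary factor of any dimension**: `DimHodge (n + k) → DimHodge n`. For an
`n`-fold `X`, the `(n + k)`-fold `X × ℙᵏ` satisfies the Hodge conjecture by hypothesis, and the Hodge
conjecture descends along the surjection `pr₁ : X × ℙᵏ → X` (`hodgeConjectureFor_of_tensor_left`).
[cite: Arapura2006, §4 Lemma 4.2 and §1 Cor. 1.2] [cite: VoisinHodgeI2002, §7.3.2 Lemma 7.28] -/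
theorem dimHodge_of_add {n k : ℕ} (h : DimHodge (n + k)) : DimHodge n := by
  intro X hX
  have hP : Motives.IsSmoothProjective k (Motives.projectiveSpace k ℂ) :=
    Motives.isSmoothProjective_projectiveSpace_holds ℂ k
  exact hodgeConjectureFor_of_tensor_left hX hP (h (Motives.IsSmoothProjective.tensor_holds hX hP))

/-- One step of the chain: `DimHodge (n + 1) → DimHodge n` (`X × ℙ¹`). [cite: Arapura2006, §4 Lemma 4.2] -/
theorem dimHodge_of_succ {n : ℕ} (h : DimHodge (n + 1)) : DimHodge n :=
  dimHodge_of_add h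

/-- `DimHodge` is antitone: `n ≤ n' → DimHodge n' → DimHodge n`. [cite: Arapura2006, §4 Lemma 4.2] -/
theorem dimHodge_of_le {n n' : ℕ} (hnn' : n ≤ n') (h : DimHodge n') : DimHodge n := by
  obtain ⟨k, rfl⟩ := Nat.exists_eq_add_of_le hnn'
  exact dimHodge_of_add h

/-- `DimHodge : ℕ → Prop` is an antitone family of statements (order on `Prop` = implication): its
truth set is a down-set of `ℕ` containing `0, 1, 2, 3`. [cite: Arapura2006, §4 Lemma 4.2] -/
theorem dimHodge_antitone : Antitone DimHodge :=
  fun _ _ hnn' h ↦ dimHodge_of_le hnn' h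

/-- A counterexample propagates upward: if the Hodge conjecture fails for some `n`-fold it fails for
some `n'`-fold for every `n' ≥ n` (namely a product with `ℙ^{n' - n}`). [cite: Arapura2006, §4 Lemma 4.2] -/
theorem not_dimHodge_of_le {n n' : ℕ} (hnn' : n ≤ n') (h : ¬ DimHodge n) : ¬ DimHodge n' :=
  fun h' ↦ h (dimHodge_of_le hnn' h')

/-- **The summit from any unbounded set of dimensions**: if `S ⊆ ℕ` is unbounded then
`HodgeConjecture ↔ ∀ s ∈ S, DimHodge s` — it suffices to prove the Hodge conjecture for varieties
whose dimension lies in `S` (odd dimensions, multiples of `1000`, primes, …).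
[cite: Arapura2006, §4 Lemma 4.2] [cite: Deligne2000, §1] -/
theorem hodgeConjecture_iff_dimHodge_of_unbounded {S : Set ℕ} (hS : ∀ n, ∃ s ∈ S, n ≤ s) :
    _root_.HodgeConjecture ↔ ∀ s ∈ S, DimHodge s := by
  refine ⟨fun h s _ ↦ dimHodge_of_hodgeConjecture h s,
    fun h ↦ hodgeConjecture_of_forall_dimHodge fun n ↦ ?_⟩
  obtain ⟨s, hs, hns⟩ := hS n
  exact dimHodge_of_le hns (h s hs)

/-- Example: for every `k ≥ 1`, `HodgeConjecture ↔ ∀ n, DimHodge (k * n)` — the Hodge conjecture for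
varieties of dimension divisible by `k` is the whole conjecture. [cite: Arapura2006, §4 Lemma 4.2] -/
theorem hodgeConjecture_iff_forall_dimHodge_mul {k : ℕ} (hk : 1 ≤ k) :
    _root_.HodgeConjecture ↔ ∀ n, DimHodge (k * n) := by
  refine ⟨fun h n ↦ dimHodge_of_hodgeConjecture h _,
    fun h ↦ hodgeConjecture_of_forall_dimHodge fun n ↦ ?_⟩
  exact dimHodge_of_le (Nat.le_mul_of_pos_left n hk) (h n)

/-- **From infinitely many dimensions**: `HodgeConjecture ↔ ∀ n₀, ∃ n ≥ n₀, DimHodge n`.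
[cite: Arapura2006, §4 Lemma 4.2] [cite: Deligne2000, §1] -/
theorem hodgeConjecture_iff_frequently_dimHodge :
    _root_.HodgeConjecture ↔ ∀ n₀ : ℕ, ∃ n, n₀ ≤ n ∧ DimHodge n := by
  refine ⟨fun h n₀ ↦ ⟨n₀, le_rfl, dimHodge_of_hodgeConjecture h n₀⟩,
    fun h ↦ hodgeConjecture_of_forall_dimHodge fun n ↦ ?_⟩
  obtain ⟨n', hnn', hn'⟩ := h n
  exact dimHodge_of_le hnn' hn'

/-- **From all large dimensions**: `HodgeConjecture ↔ ∃ n₀, ∀ n ≥ n₀, DimHodge n`.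
[cite: Arapura2006, §4 Lemma 4.2] [cite: Deligne2000, §1] -/
theorem hodgeConjecture_iff_eventually_dimHodge :
    _root_.HodgeConjecture ↔ ∃ n₀ : ℕ, ∀ n, n₀ ≤ n → DimHodge n := by
  refine ⟨fun h ↦ ⟨0, fun n _ ↦ dimHodge_of_hodgeConjecture h n⟩, fun ⟨n₀, h⟩ ↦ ?_⟩
  exact hodgeConjecture_iff_frequently_dimHodge.mpr fun n₁ ↦
    ⟨max n₀ n₁, le_max_right _ _, h _ (le_max_left _ _)⟩

/-- **Threshold form of the summit, by dimension.** The Hodge conjecture FAILS iff there is a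
dimension `D₁ ≥ 4` such that `DimHodge n ↔ n < D₁` for every `n`: the truth set of `DimHodge` is a
down-set containing `0,…,3` (`dimHodge_of_le_three`), all of `ℕ` iff the conjecture holds.
[cite: Deligne2000, §1] [cite: VoisinHodgeI2002, §11.3] [cite: Arapura2006, §4 Lemma 4.2] -/
theorem not_hodgeConjecture_iff_exists_dimThreshold :
    ¬ _root_.HodgeConjecture ↔ ∃ D₁ : ℕ, 4 ≤ D₁ ∧ ∀ n, DimHodge n ↔ n < D₁ := by
  classical
  constructor
  · intro h
    have hex : ∃ n, ¬ DimHodge n := by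
      by_contra hne
      push Not at hne
      exact h (hodgeConjecture_of_forall_dimHodge hne)
    refine ⟨Nat.find hex, ?_, fun n ↦ ⟨fun hn ↦ ?_, fun hn ↦ ?_⟩⟩
    · by_contra hlt
      exact Nat.find_spec hex (dimHodge_of_le_three (by omega))
    · by_contra hle
      exact Nat.find_spec hex (dimHodge_of_le (by omega) hn)
    · by_contra hn'
      exact Nat.find_min hex hn hn'
  · rintro ⟨D₁, -, hD₁⟩ h
    exact lt_irrefl D₁ ((hD₁ D₁).1 (dimHodge_of_hodgeConjecture h D₁))

/-- **Threshold form of the summit, by middle degree** (the `MiddleHodge` chain of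
`SoloBlindMiddleMonotone`): the Hodge conjecture FAILS iff there is `M₁ ≥ 2` with
`MiddleHodge m ↔ m < M₁` for every `m`. [cite: BrosnanFangNiePearlstein2009, §6 Lemma 48]
[cite: Deligne2000, §1] -/
theorem not_hodgeConjecture_iff_exists_middleThreshold :
    ¬ _root_.HodgeConjecture ↔ ∃ M₁ : ℕ, 2 ≤ M₁ ∧ ∀ m, MiddleHodge m ↔ m < M₁ := by
  classical
  constructor
  · intro h
    have hex : ∃ m, ¬ MiddleHodge m := by
      by_contra hne
      push Not at hne
      exact h (hodgeConjecture_of_forall_middleHodge hne)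
    refine ⟨Nat.find hex, ?_, fun m ↦ ⟨fun hm ↦ ?_, fun hm ↦ ?_⟩⟩
    · by_contra hlt
      exact Nat.find_spec hex (middleHodge_of_le_one (by omega))
    · by_contra hle
      exact Nat.find_spec hex (middleHodge_of_le (by omega) hm)
    · by_contra hm'
      exact Nat.find_min hex hm hm'
  · rintro ⟨M₁, -, hM₁⟩ h
    exact lt_irrefl M₁ ((hM₁ M₁).1 (middleHodge_of_hodgeConjecture h M₁))

/-! ### Links between the three chains -/

/-- `DimHodge (2m) → MiddleHodge m`: the middle degree of `2m`-folds is an instance of the Hodge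
conjecture for `2m`-folds. [cite: Deligne2000, §1] -/
theorem middleHodge_of_dimHodge_two_mul {m : ℕ} (h : DimHodge (2 * m)) : MiddleHodge m :=
  fun _ hX c hc hpp ↦ (h hX).2 m c hc hpp

/-- `DimHodge (2N) → SquareHodge N` (via `MiddleHodge N`, `squareHodge_of_middleHodge`).
[cite: Deligne2000, §1] -/
theorem squareHodge_of_dimHodge_two_mul {N : ℕ} (h : DimHodge (2 * N)) : SquareHodge N :=
  squareHodge_of_middleHodge (middleHodge_of_dimHodge_two_mul h)

/-- `SquareHodge (2n) → DimHodge n`: the square chain at level `2n` settles every `n`-fold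
(`hodgeConjectureFor_of_squareHodge`). [cite: BrosnanFangNiePearlstein2009, §6 Lemma 48] -/
theorem dimHodge_of_squareHodge_two_mul {n : ℕ} (h : SquareHodge (2 * n)) : DimHodge n :=
  fun _ hX ↦ hodgeConjectureFor_of_squareHodge h hX le_rfl

/-- **`MiddleHodge n → DimHodge n`** (sharp link, Brosnan–Fang–Nie–Pearlstein's Lemma 48 one
variety at a time): for a rational `(p,p)`-class `c` on the smooth projective `n`-fold `X`,
if `2p < n` then `c` is decided by the middle degree of the `2(n - p)`-fold `X × ℙ^{n - 2p}`
(`mem_algebraicClasses_of_middle_of_prod_projectiveSpace`, `c = λ⁻¹ pr_{1*}(pr₁^* c ∪ pr₂^* ρ)`);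
if `2p = n` it is a middle-degree class; if `n < 2p ≤ 2n` then `pr₁^* c` is a middle-degree class of
the `2p`-fold `X × ℙ^{2p - n}` and `c` is algebraic by descent along `pr₁`
(`mem_algebraicClasses_left_of_map_fst_mem`); if `p > n` then `H²ᵖ = 0`. In every case the
auxiliary dimension is `2m` with `m ≤ n`, and `MiddleHodge` is antitone (`middleHodge_of_le`).
[cite: BrosnanFangNiePearlstein2009, §6 Lemma 48] [cite: VoisinHodgeI2002, §7.3.2 and §11.1.2] -/
theorem dimHodge_of_middleHodge {n : ℕ} (h : MiddleHodge n) : DimHodge n := by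
  intro X hX
  refine ⟨nonempty_hodgeModel_holds hX, fun p c hc hpp ↦ ?_⟩
  rcases Nat.lt_trichotomy (2 * p) n with hlt | heq | hgt
  · -- `2p < n`: product step at `ℙʳ`, `r = n - 2p ≥ 1`, middle degree of the `2(p + r)`-fold `X × ℙʳ`
    obtain ⟨r, hr⟩ : ∃ r, 2 * p + r = n := ⟨n - 2 * p, by omega⟩
    refine mem_algebraicClasses_of_middle_of_prod_projectiveSpace hodgePQ_independent_of_hodgeModel_holds
      (fun _ _ ↦ nonempty_hodgeModel_holds) (fun _ _ hY ↦ cupPreservesHodgeType_holds' hY) hX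
      (p := p) (r := r) hr (by omega) (fun c' hc' hc'pp ↦ ?_) c hc hpp
    have hP : Motives.IsSmoothProjective r (Motives.projectiveSpace r ℂ) :=
      Motives.isSmoothProjective_projectiveSpace_holds ℂ r
    have hV := Motives.IsSmoothProjective.tensor_holds hX hP
    have e : n + r = 2 * (p + r) := by omega
    rw [e] at hV
    exact middleHodge_of_le (show p + r ≤ n by omega) h hV c' hc' hc'pp
  · -- `2p = n`: the middle degree of `X` itself (`MiddleHodge p`, `p ≤ n`)
    subst heq
    exact middleHodge_of_le (show p ≤ 2 * p by omega) h hX c hc hpp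
  · by_cases hpn : p ≤ n
    · -- `n < 2p ≤ 2n`: pull back to the `2p`-fold `X × ℙᵉ`, `e = 2p - n`, and descend along `pr₁`
      obtain ⟨e, he⟩ : ∃ e, n + e = 2 * p := ⟨2 * p - n, by omega⟩
      have hE : Motives.IsSmoothProjective e (Motives.projectiveSpace e ℂ) :=
        Motives.isSmoothProjective_projectiveSpace_holds ℂ e
      have hXE : Motives.IsSmoothProjective (n + e) (X ⊗ Motives.projectiveSpace e ℂ) :=
        Motives.IsSmoothProjective.tensor_holds hX hE
      have htyp : IsOfHodgeType (n + e) (X ⊗ Motives.projectiveSpace e ℂ) (2 * p) p p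
          (complexBetti.map (fst X (Motives.projectiveSpace e ℂ)) (2 * p) c) :=
        hpp.map_of_isSmoothProjective hXE hX (fst X (Motives.projectiveSpace e ℂ))
      rw [he] at hXE htyp
      have halg : complexBetti.map (fst X (Motives.projectiveSpace e ℂ)) (2 * p) c ∈
          algebraicClasses (X ⊗ Motives.projectiveSpace e ℂ) p :=
        middleHodge_of_le hpn h hXE _ (hc.map _) htyp
      exact mem_algebraicClasses_left_of_map_fst_mem hX hE halg
    · -- `p > n`: `H²ᵖ(X) = 0`
      haveI := subsingleton_complexBetti hX (k := 2 * p) (by omega)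
      rw [Subsingleton.elim c 0]
      exact Submodule.zero_mem _

/-- The two forms `DimHodge n ↔` "middle degree up to dimension `2n`": `MiddleHodge n → DimHodge n`
and `DimHodge (2n) → MiddleHodge n` chain to `MiddleHodge (2n) → MiddleHodge n` — consistent with
(and weaker than) `middleHodge_of_le`. Recorded as the equivalence available at a FIXED level:
`DimHodge (2n) → DimHodge n` factors through `MiddleHodge n`. [cite: BrosnanFangNiePearlstein2009, §6 Lemma 48] -/
theorem dimHodge_of_dimHodge_two_mul_via_middle {n : ℕ} (h : DimHodge (2 * n)) : DimHodge n :=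
  dimHodge_of_middleHodge (middleHodge_of_dimHodge_two_mul h)

/-! ### The threshold triangle -/

/-- **Thresholds, middle degree vs dimension**: if `M₁` and `D₁` are the thresholds of the
`MiddleHodge` and `DimHodge` chains then `M₁ ≤ D₁ ≤ 2 M₁` (`dimHodge_of_middleHodge`,
`middleHodge_of_dimHodge_two_mul`). [cite: BrosnanFangNiePearlstein2009, §6 Lemma 48] -/
theorem middleThreshold_le_dimThreshold_le {M₁ D₁ : ℕ} (hM : ∀ m, MiddleHodge m ↔ m < M₁)
    (hD : ∀ n, DimHodge n ↔ n < D₁) : M₁ ≤ D₁ ∧ D₁ ≤ 2 * M₁ := by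
  constructor
  · by_contra hlt
    exact lt_irrefl D₁ ((hD D₁).1 (dimHodge_of_middleHodge ((hM D₁).2 (by omega))))
  · by_contra hlt
    exact lt_irrefl M₁ ((hM M₁).1 (middleHodge_of_dimHodge_two_mul ((hD (2 * M₁)).2 (by omega))))

/-- **Thresholds, middle degree vs squares**: `M₁ ≤ N₁ ≤ 3 M₁` (`squareHodge_of_middleHodge`,
`middleHodge_of_squareHodge` with `3m ≤ N`). [cite: BrosnanFangNiePearlstein2009, §6 Lemma 48] -/
theorem middleThreshold_le_squareThreshold_le {M₁ N₁ : ℕ} (hM : ∀ m, MiddleHodge m ↔ m < M₁)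
    (hN : ∀ N, SquareHodge N ↔ N < N₁) : M₁ ≤ N₁ ∧ N₁ ≤ 3 * M₁ := by
  constructor
  · by_contra hlt
    exact lt_irrefl N₁ ((hN N₁).1 (squareHodge_of_middleHodge ((hM N₁).2 (by omega))))
  · by_contra hlt
    exact lt_irrefl M₁ ((hM M₁).1
      (middleHodge_of_squareHodge ((hN (3 * M₁)).2 (by omega)) le_rfl))

/-- **Thresholds, dimension vs squares**: `N₁ ≤ 2 D₁` and `D₁ ≤ 2 N₁` (`squareHodge_of_dimHodge_two_mul`,
`dimHodge_of_squareHodge_two_mul`). [cite: BrosnanFangNiePearlstein2009, §6 Lemma 48] -/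
theorem squareThreshold_le_dimThreshold_le {D₁ N₁ : ℕ} (hD : ∀ n, DimHodge n ↔ n < D₁)
    (hN : ∀ N, SquareHodge N ↔ N < N₁) : N₁ ≤ 2 * D₁ ∧ D₁ ≤ 2 * N₁ := by
  constructor
  · by_contra hlt
    exact lt_irrefl D₁ ((hD D₁).1 (dimHodge_of_squareHodge_two_mul ((hN (2 * D₁)).2 (by omega))))
  · by_contra hlt
    exact lt_irrefl N₁ ((hN N₁).1 (squareHodge_of_dimHodge_two_mul ((hD (2 * N₁)).2 (by omega))))

/-- **The threshold triangle, assembled.** If the Hodge conjecture fails, the three chains have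
thresholds `M₁ ≥ 2`, `D₁ ≥ 4`, `N₁ ≥ 2` with `M₁ ≤ D₁ ≤ 2 M₁`, `M₁ ≤ N₁ ≤ 3 M₁`, `N₁ ≤ 2 D₁`,
`D₁ ≤ 2 N₁`: one counterexample pins the first bad middle dimension, the first bad dimension and the
first bad square level to within a factor `3` of one another.
[cite: BrosnanFangNiePearlstein2009, §6 Lemma 48] [cite: Deligne2000, §1] -/
theorem exists_threshold_triangle_of_not_hodgeConjecture (h : ¬ _root_.HodgeConjecture) :
    ∃ M₁ D₁ N₁ : ℕ, (2 ≤ M₁ ∧ 4 ≤ D₁ ∧ 2 ≤ N₁) ∧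
      (∀ m, MiddleHodge m ↔ m < M₁) ∧ (∀ n, DimHodge n ↔ n < D₁) ∧ (∀ N, SquareHodge N ↔ N < N₁) ∧
      (M₁ ≤ D₁ ∧ D₁ ≤ 2 * M₁) ∧ (M₁ ≤ N₁ ∧ N₁ ≤ 3 * M₁) ∧ (N₁ ≤ 2 * D₁ ∧ D₁ ≤ 2 * N₁) := by
  obtain ⟨M₁, hM2, hM⟩ := not_hodgeConjecture_iff_exists_middleThreshold.mp h
  obtain ⟨D₁, hD4, hD⟩ := not_hodgeConjecture_iff_exists_dimThreshold.mp h
  obtain ⟨N₁, hN2, hN⟩ := not_hodgeConjecture_iff_exists_threshold.mp h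
  exact ⟨M₁, D₁, N₁, ⟨hM2, hD4, hN2⟩, hM, hD, hN, middleThreshold_le_dimThreshold_le hM hD,
    middleThreshold_le_squareThreshold_le hM hN, squareThreshold_le_dimThreshold_le hD hN⟩

end Summit.HodgeConjecture.HodgeConjecture.Theorems.SoloBlind

end
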